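import Summits.HodgeConjecture.HodgeConjecture.Theses.CurveNetMordellWeil
import Literature.AlgebraicGeometry.HodgeTheory.MiddleDimensionReductionOfHodgeModels
import Literature.AlgebraicGeometry.HodgeTheory.MiddleDimensionReductionHolds
import Literature.AlgebraicGeometry.HodgeTheory.CupPreservesHodgeTypeOfDeRham
import Literature.AlgebraicGeometry.HodgeTheory.SupportedHodgeClassDescent
import Literature.AlgebraicGeometry.HodgeTheory.GysinFormalismPushforward
import Literature.AlgebraicGeometry.Resolution.ProjectiveResolutionProofs
import Literature.AlgebraicGeometry.Motives.FiniteProjectionExists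

/-!
# Route CurveNetMordellWeil — what the crux `VerticalSupportMiddle` AS TYPED contains
(evidence for item stmt-HodgeConjecture-2782; helpers `--supports` it)

The crux `VerticalSupportMiddle` quantifies over EVERY surjective `pr : X ⟶ ℙ^{2q-1}` on a smooth
projective `2q`-fold `X` (`q ≥ 2`), with no connectedness hypothesis on the fibres. Two elementary
facts about the item as typed, proved on the tree's real carriers:

* `verticalSupportMiddle_of_hodgeConjecture` — the Hodge conjecture implies the item outright (the
  algebraic summand of its conclusion already contains every Hodge class): the item is "HC-true" for
  every `pr`, whatever the fibres.
* `verticalSupportMiddle_hardness` — conversely the item, at `q = p + 1`, contains the Hodge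
  conjecture "modulo coniveau one" for `(p,p)`-classes on every smooth projective `(2p+1)`-fold
  `B` mapping onto `ℙ^{2p+1}` (`p ≥ 1`): apply the item to the surjection
  `pr₁ ≫ τ : B × ℙ¹ ⟶ ℙ^{2p+1}` (a `2(p+1)`-fold over `ℙ^{2(p+1)-1}` with DISCONNECTED general fibres,
  `deg τ` copies of `ℙ¹`) and to the rational `(p+1,p+1)`-class `pr₁^* c ∪ pr₂^* ρ` (`ρ ≠ 0` a rational
  top class of `ℙ¹`), which is of MIDDLE degree on `B × ℙ¹`; pushing down by the Gysin morphism
  `pr₁_*` (projection formula `pr₁_*(pr₁^* c ∪ pr₂^* ρ) = λ c`, `λ ≠ 0`; Gysin images of algebraic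
  classes are algebraic; Gysin maps are compatible with supports) gives
  `c ∈ algebraicClasses B p ⊔ span{w | w dies off B ∖ τ⁻¹T, T ⊊ ℙ^{2p+1} closed}`.
* `verticalSupportMiddle_coniveau_one`, `verticalSupportMiddle_coniveau_one_of_odd` — hence every
  rational `(p,p)`-class on EVERY smooth projective `(2p+1)`-fold has coniveau `≥ 1` (a finite
  surjection `B ⟶ ℙ^{2p+1}` always exists, projective Noether normalisation
  `IsSmoothProjective.exists_isFinite_surjective_hom`). For `p = 2` this is the Hodge conjecture for
  `(2,2)`-classes on all smooth projective FIVEFOLDS read through Deligne's descent (and thereby,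
  via `B'' × ℙ¹`, on all fourfolds) — with no curve-net geometry entering.

* (`q = 3`, appended) `verticalSupportMiddle_hodge_two_two_fivefolds`,
  `verticalSupportMiddle_hodge_two_two_fourfolds`, `verticalSupportMiddle_imp_hodge_fourfolds` — granted
  Lefschetz `(1,1)` (the route's own support item `LefschetzOneOne`) and the catalogued descent facts
  `Deligne1974_ker_restrictCompl_eq_iSup_range_complexGysin` (Hodge III Cor. 8.2.8) and
  `Voisin2025_hodgeClass_lift_complexGysin` (Voisin 2025 Cor. 2.12), the item implies that every rational
  `(2,2)`-class on every smooth projective FIVEFOLD, hence (the `ℙ¹`-step of BFNP Lemma 48, pull-backs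
  only) on every smooth projective FOURFOLD, is algebraic — the Hodge conjecture for fourfolds — via the
  degree-aware descent `supportedHodgeClass_mem_algebraicClasses_of_codim_lt`.

So the `q`-instance of the item as typed is not only "middle-degree HC for `2q`-folds fibred in
curves" (its intended content, fed by `CurveNetExists` in the route's `closes`) but also contains the
codimension-`(q-1)` Hodge conjecture on odd-dimensional varieties, which the route's induction on the
codimension is supposed to DELIVER at stage `q - 1`, not to assume inside the stage-`q` crux. The
bookkeeping is that of the sibling file `CurveNetMordellWeilVerticalSupportAboveMiddleHardness`
(item 2785) one dimension up; the Hodge-theoretic inputs are the tree's theorems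
`nonempty_hodgeModel_holds`, `hodgePQ_independent_of_hodgeModel_holds`, `exists_deRhamIsoFamily_holds`.
-/

noncomputable section

-- `Summit.HodgeConjecture.HodgeConjecture.Theorems` is the mandated namespace (single-problem summit:
-- Problem = Summit), which `linter.dupNamespace` flags on every declaration; the lakefile turns the
-- linter off tree-wide (weak option), restated here so stand-alone elaboration is warning-free too.
set_option linter.dupNamespace false

open scoped Manifold ContDiff
open CategoryTheory CategoryTheory.Limits AlgebraicGeometry MonoidalCategory CartesianMonoidalCategory
open Literature.AlgebraicGeometry Literature.AlgebraicGeometry.Motives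
  Literature.AlgebraicGeometry.HodgeTheory Literature.AlgebraicTopology.SingularHomology
open Summit.HodgeConjecture.HodgeConjecture.Theses.CurveNetMordellWeil (VerticalSupportMiddle)

namespace Summit.HodgeConjecture.HodgeConjecture.Theorems

/-- **The Hodge conjecture implies the crux `VerticalSupportMiddle` as typed**, for every surjective
`pr` (connected fibres or not): the conclusion `span{rational (q,q)} ≤ algebraicClasses X q ⊔ _`
already follows from its algebraic summand. [folklore] -/
theorem verticalSupportMiddle_of_hodgeConjecture (hHC : _root_.HodgeConjecture) :
    VerticalSupportMiddle := by
  intro q m X pr hX _hq _hm _hsurj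
  refine le_sup_of_le_left (Submodule.span_le.2 ?_)
  rintro c ⟨hc, hh⟩
  exact (hHC hX).2 q c hc hh

/-- **`VerticalSupportMiddle` as typed contains the codimension-`p` Hodge conjecture modulo
coniveau one on odd-dimensional varieties.** If the item holds, then for every smooth projective `B`
of dimension `2p + 1` (`p ≥ 1`) with a surjective morphism `τ : B ⟶ ℙ^{2p+1}`, every rational
`(p,p)`-class `c` on `B` lies in
`algebraicClasses B p ⊔ span{w | w dies off B ∖ τ⁻¹T for some Zariski-closed T ⊊ ℙ^{2p+1}}`.
Proof: apply the item (at `q = p + 1`, `m = 2p + 1`) to the surjection `pr₁ ≫ τ : B × ℙ¹ ⟶ ℙ^{2p+1}`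
(dimension `2(p+1)`) and the rational middle-degree `(p+1,p+1)`-class `pr₁^* c ∪ pr₂^* ρ`, then push
down by `pr₁_*` (projection formula `pr₁_*(pr₁^* c ∪ pr₂^* ρ) = λ c`, `λ ≠ 0`; Gysin images of
algebraic classes are algebraic; Gysin maps are compatible with supports). [folklore] -/
theorem verticalSupportMiddle_hardness (hMid : VerticalSupportMiddle)
    {p : ℕ} (hp : 1 ≤ p) {B : SchemeOver ℂ} (hB : IsSmoothProjective (2 * p + 1) B)
    (τ : B ⟶ projectiveSpace (2 * p + 1) ℂ) (hτ : Function.Surjective τ.left.base)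
    (c : complexBetti B (2 * p)) (hc : IsRationalClass c)
    (hpp : IsOfHodgeType (2 * p + 1) B (2 * p) p p c) :
    c ∈ algebraicClasses B p ⊔ Submodule.span ℂ {w : complexBetti B (2 * p) |
      ∃ T : Set (projectiveSpace (2 * p + 1) ℂ).left, IsClosed T ∧ T ≠ Set.univ ∧
        complexBetti.restrictCompl B (τ.left.base ⁻¹' T) (2 * p) w = 0} := by
  -- an orientation family and its Poincaré duality; the support fact for Gysin maps (all proved)
  let μ : OrientationFamily := fun n Y hY ↦ (Motives.ComplexPoints.isOrientableOver ℂ hY).some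
  have hμ : μ.HasPoincareDuality := OrientationFamily.hasPoincareDuality μ
  have hS := gysinMap_restrictCompl_eq_zero_of_field.{0, 0} ℂ
  -- the Hodge-theoretic inputs of the product trick (all proved in the tree)
  have hI : hodgePQ_independent_of_hodgeModel := hodgePQ_independent_of_hodgeModel_holds
  have hA : ∀ ⦃n : ℕ⦄ ⦃X : Motives.SchemeOver ℂ⦄, nonempty_hodgeModel n X :=
    fun _ _ ↦ nonempty_hodgeModel_holds
  have hcup : ∀ ⦃n : ℕ⦄ ⦃X : Motives.SchemeOver ℂ⦄, IsSmoothProjective n X →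
      CupPreservesHodgeType n X :=
    fun _ _ hX ↦ cupPreservesHodgeType_of_nonempty_hodgeModel hI (@hA _ _)
      (fun E _ _ _ ↦ Literature.NumberTheory.Transcendental.exists_deRhamIsoFamily_holds E) hX
  -- the auxiliary factor `P = ℙ¹`, a complex point `t`, the even-dimensional `V = B × P`
  set P := Motives.projectiveSpace 1 ℂ with hPdef
  have hP : IsSmoothProjective 1 P := Motives.isSmoothProjective_projectiveSpace_holds ℂ 1
  haveI := connectedSpace_complexPoints hP
  obtain ⟨t⟩ : Nonempty (Motives.ComplexPoints P) := inferInstance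
  haveI := connectedSpace_complexPoints hB
  obtain ⟨x₀⟩ : Nonempty (Motives.ComplexPoints B) := inferInstance
  have hV : IsSmoothProjective (2 * (p + 1)) (B ⊗ P) := by
    rw [show 2 * (p + 1) = 2 * p + 1 + 1 by ring]
    exact Motives.IsSmoothProjective.tensor_holds hB hP
  haveI : LocallyOfFiniteType P.hom := locallyOfFiniteType_of_isSmoothProjective hP
  haveI : IsClosedImmersion (Motives.sliceAt B t).left := Motives.isClosedImmersion_sliceAt_left t
  haveI := pathConnectedSpace_complexPoints hB
  -- a non-zero rational top-degree class `ρ` on `P`, of type `(1, 1)`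
  obtain ⟨ρ, hρ, hρ0⟩ := exists_isRationalClass_ne_zero_of_degree_eq_two_mul hP
  obtain ⟨A⟩ := (hA (n := 1) (X := P)).nonempty hP
  have hρtyp : IsOfHodgeType 1 P (2 * 1) 1 1 ρ := isOfHodgeType_of_degree_eq_two_mul A ρ
  -- `pr₂^* ρ` dies off the slice `s_t(B) = pr₂⁻¹(t)` …
  have hρsupp : complexBetti.restrictCompl (B ⊗ P) (Set.range (Motives.sliceAt B t).left.base)
      (2 * 1) (complexBetti.map (snd B P) (2 * 1) ρ) = 0 := by
    rw [range_sliceAt_left_base]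
    exact complexBetti.restrictCompl_map_eq_zero (snd B P) (restrictCompl_pt_eq_zero hP le_rfl t ρ)
  -- … hence is a Gysin image `s_{t*} y`, `y ∈ H⁰(B(ℂ); ℂ) = ℂ · 1`: `pr₂^* ρ = λ · s_{t*} 1`
  obtain ⟨y, hy⟩ := exists_complexGysin_eq_of_isClosedImmersion μ hV hB (Motives.sliceAt B t)
    (show 0 + 2 * (2 * (p + 1)) = 2 * 1 + 2 * (2 * p + 1) by ring) hρsupp
  obtain ⟨lam, rfl⟩ := singularCohomology.exists_eq_smul_one y
  rw [map_smul] at hy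
  -- `λ ≠ 0`: `pr₂^*` is injective (`pr₂` has the section `(x₀, 𝟙)`) and `ρ ≠ 0`
  have hlam : lam ≠ 0 := by
    rintro rfl
    rw [zero_smul] at hy
    apply hρ0
    let j : P ⟶ B ⊗ P := CartesianMonoidalCategory.lift (Motives.toSpecOver P ≫ x₀) (𝟙 P)
    have hj : j ≫ snd B P = 𝟙 P := CartesianMonoidalCategory.lift_snd _ _
    have hρj : complexBetti.map j (2 * 1) (complexBetti.map (snd B P) (2 * 1) ρ) = ρ := by
      rw [← CategoryTheory.comp_apply, ← complexBetti.map_comp, hj, complexBetti.map_id,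
        CategoryTheory.id_apply]
    rw [← hρj, ← hy, map_zero]
  -- the class `c' = pr₁^* c ∪ pr₂^* ρ` on `V`: rational, of type `(p + 1, p + 1)`, MIDDLE degree
  set c' : complexBetti (B ⊗ P) (2 * (p + 1)) :=
    cupProduct (show 2 * p + 2 * 1 = 2 * (p + 1) by ring) (complexBetti.map (fst B P) (2 * p) c)
      (complexBetti.map (snd B P) (2 * 1) ρ) with hc'def
  have hc'rat : IsRationalClass c' := (hc.map _).cup _ (hρ.map _)
  have hc'typ : IsOfHodgeType (2 * (p + 1)) (B ⊗ P) (2 * (p + 1)) (p + 1) (p + 1) c' :=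
    hcup hV _ (preservesHodgeType_of_nonempty_hodgeModel hI (hA (X := B ⊗ P)) hV hB (fst B P) hpp)
      (preservesHodgeType_of_nonempty_hodgeModel hI (hA (X := B ⊗ P)) hV hP (snd B P) hρtyp)
  -- the surjection `pr = pr₁ ≫ τ : V ⟶ ℙ^{2p+1}` (disconnected fibres!)
  have hfst : Function.Surjective (fst B P).left.base := by
    intro b
    refine ⟨(Motives.sliceAt B t).left.base b, ?_⟩
    have h1 : (Motives.sliceAt B t ≫ fst B P).left.base b = b := by
      rw [Motives.sliceAt_fst]
      rfl
    rwa [Over.comp_left, Scheme.Hom.comp_apply] at h1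
  have hsurj : Function.Surjective (fst B P ≫ τ).left.base := by
    intro z
    obtain ⟨b, rfl⟩ := hτ z
    obtain ⟨v, rfl⟩ := hfst b
    exact ⟨v, by rw [Over.comp_left, Scheme.Hom.comp_apply]⟩
  -- THE ITEM, applied at `q = p + 1`, `m = 2p + 1`
  have key := hMid (fst B P ≫ τ) hV (show 2 ≤ p + 1 by omega)
    (show 2 * p + 1 + 1 = 2 * (p + 1) by ring) hsurj
  have hc'mem := key (Submodule.subset_span ⟨hc'rat, hc'typ⟩)
  -- push down by `pr₁_*`
  set g := complexGysin μ hV hB (fst B P)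
    (show 2 * (p + 1) + 2 * (2 * p + 1) = 2 * p + 2 * (2 * (p + 1)) by ring) with hgdef
  have hgc' : g c' ∈ algebraicClasses B p ⊔ Submodule.span ℂ {w : complexBetti B (2 * p) |
      ∃ T : Set (projectiveSpace (2 * p + 1) ℂ).left, IsClosed T ∧ T ≠ Set.univ ∧
        complexBetti.restrictCompl B (τ.left.base ⁻¹' T) (2 * p) w = 0} := by
    obtain ⟨a, ha, s, hs, has⟩ := Submodule.mem_sup.1 hc'mem
    rw [← has, map_add]
    refine Submodule.add_mem_sup ?_ ?_
    · -- Gysin images of algebraic classes are algebraic (coniveau drops by the relative dimension)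
      exact complexGysin_mem_algebraicClasses hS μ hμ hV hB (fst B P) (by omega) _ ha
    · -- Gysin maps are compatible with supports: vertical classes go to `τ`-vertical classes
      suffices h : Submodule.span ℂ {c : complexBetti (B ⊗ P) (2 * (p + 1)) |
          IsRationalClass c ∧
          IsOfHodgeType (2 * (p + 1)) (B ⊗ P) (2 * (p + 1)) (p + 1) (p + 1) c ∧
          ∃ T : Set (projectiveSpace (2 * p + 1) ℂ).left, IsClosed T ∧ T ≠ Set.univ ∧
            complexBetti.restrictCompl (B ⊗ P) ((fst B P ≫ τ).left.base ⁻¹' T) (2 * (p + 1)) c = 0}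
          ≤ (Submodule.span ℂ {w : complexBetti B (2 * p) |
            ∃ T : Set (projectiveSpace (2 * p + 1) ℂ).left, IsClosed T ∧ T ≠ Set.univ ∧
              complexBetti.restrictCompl B (τ.left.base ⁻¹' T) (2 * p) w = 0}).comap g from h hs
      refine Submodule.span_le.2 ?_
      rintro v ⟨-, -, T, hT, hTne, hv⟩
      refine Submodule.subset_span ⟨T, hT, hTne, ?_⟩
      have hpre : (fst B P ≫ τ).left.base ⁻¹' T = (fst B P).left.base ⁻¹' (τ.left.base ⁻¹' T) := by
        ext x
        rw [Set.mem_preimage, Set.mem_preimage, Set.mem_preimage, Over.comp_left,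
          Scheme.Hom.comp_apply]
      rw [hpre] at hv
      exact complexGysin_restrictCompl_eq_zero hS μ hμ hV hB (fst B P) _
        (hT.preimage τ.left.base.hom.continuous) v hv
  -- `pr₁_* c' = c ∪ pr₁_* pr₂^* ρ = c ∪ λ · (s_t ≫ pr₁)_* 1 = λ c`
  have hone : complexGysin μ hV hB (fst B P)
      (show 2 * 1 + 2 * (2 * p + 1) = 0 + 2 * (2 * (p + 1)) by ring)
      (complexBetti.map (snd B P) (2 * 1) ρ) = lam • singularCohomology.one ℂ (Motives.ComplexPoints B) := by
    rw [← hy, map_smul, ← LinearMap.comp_apply,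
      ← complexGysin_comp hμ hB hV hB (Motives.sliceAt B t) (fst B P)]
    simp only [Motives.sliceAt_fst]
    rw [complexGysin_id hμ hB 0, LinearMap.id_apply]
  have hcc : g c' = lam • c := by
    rw [hgdef, hc'def, complexGysin_cup hμ hV hB (fst B P) _ _
      (show 2 * 1 + 2 * (2 * p + 1) = 0 + 2 * (2 * (p + 1)) by ring) (Nat.add_zero (2 * p)), hone,
      LinearMap.map_smul, cupProduct_one]
  rw [hcc] at hgc'
  have h := Submodule.smul_mem _ lam⁻¹ hgc'
  rwa [smul_smul, inv_mul_cancel₀ hlam, one_smul] at h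

/-- **Hence every rational `(p,p)`-class on such a `B` has coniveau `≥ 1`**: if the item holds, then
for `B` smooth projective of dimension `2p + 1` (`p ≥ 1`) with a surjection `τ : B ⟶ ℙ^{2p+1}`, every
rational `(p,p)`-class lies in `N¹H²ᵖ(B(ℂ); ℂ) = supportedClasses B (2p) 1` (algebraic classes have
coniveau `p ≥ 1`; a `τ`-vertical class dies off the proper closed `τ⁻¹T`, all of whose points have
codimension `≥ 1` in the irreducible `B`). [folklore] -/
theorem verticalSupportMiddle_coniveau_one (hMid : VerticalSupportMiddle)
    {p : ℕ} (hp : 1 ≤ p) {B : SchemeOver ℂ} (hB : IsSmoothProjective (2 * p + 1) B)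
    (τ : B ⟶ projectiveSpace (2 * p + 1) ℂ) (hτ : Function.Surjective τ.left.base)
    (c : complexBetti B (2 * p)) (hc : IsRationalClass c)
    (hpp : IsOfHodgeType (2 * p + 1) B (2 * p) p p c) :
    c ∈ supportedClasses B (2 * p) 1 := by
  have hsub : {w : complexBetti B (2 * p) |
      ∃ T : Set (projectiveSpace (2 * p + 1) ℂ).left, IsClosed T ∧ T ≠ Set.univ ∧
        complexBetti.restrictCompl B (τ.left.base ⁻¹' T) (2 * p) w = 0} ⊆
      supportedClasses B (2 * p) 1 := by
    rintro w ⟨T, hT, hTne, hw⟩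
    have hT' : IsClosed (τ.left.base ⁻¹' T) := hT.preimage τ.left.base.hom.continuous
    have hTne' : τ.left.base ⁻¹' T ≠ Set.univ := by
      intro hU
      apply hTne
      refine Set.eq_univ_of_forall fun z ↦ ?_
      obtain ⟨b, rfl⟩ := hτ z
      have hb : b ∈ τ.left.base ⁻¹' T := hU ▸ Set.mem_univ b
      exact hb
    exact mem_supportedClasses_of_restrictCompl_eq_zero hT'
      (fun z hz ↦ one_le_coheight_of_mem_of_isClosed hB hT' hTne' hz) hw
  obtain ⟨a, ha, s, hs, rfl⟩ :=
    Submodule.mem_sup.1 (verticalSupportMiddle_hardness hMid hp hB τ hτ c hc hpp)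
  exact Submodule.add_mem _ (supportedClasses_mono B (2 * p) hp ha) (Submodule.span_le.2 hsub hs)

/-- **If the item holds, every rational `(p,p)`-class on every smooth projective complex variety of
ODD dimension `2p + 1` (`p ≥ 1`) has coniveau `≥ 1`** (dies off a proper Zariski-closed subset): the
surjection `τ : B ⟶ ℙ^{2p+1}` of `verticalSupportMiddle_coniveau_one` always exists — a finite one,
by projective Noether normalisation (`IsSmoothProjective.exists_isFinite_surjective_hom`,
Görtz–Wedhorn I Thm. 13.89). For `p = 2` this is the Hodge conjecture for `(2,2)`-classes on all
smooth projective fivefolds read through Deligne's coniveau/descent theorem (Hodge III, Cor. 8.2.8)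
— open, and equivalent by `B'' × ℙ¹` to the fourfold case. [cite: GortzWedhorn2020, Thm. 13.89] -/
theorem verticalSupportMiddle_coniveau_one_of_odd (hMid : VerticalSupportMiddle)
    {p : ℕ} (hp : 1 ≤ p) {B : SchemeOver ℂ} (hB : IsSmoothProjective (2 * p + 1) B)
    (c : complexBetti B (2 * p)) (hc : IsRationalClass c)
    (hpp : IsOfHodgeType (2 * p + 1) B (2 * p) p p c) :
    c ∈ supportedClasses B (2 * p) 1 := by
  obtain ⟨τ, -, hτ⟩ := hB.exists_isFinite_surjective_hom
  exact verticalSupportMiddle_coniveau_one hMid hp hB τ τ.left.surjective c hc hpp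

/-- **Registered form** (arrow form, one line; registered on item stmt-HodgeConjecture-2782 via
`ledger workitem stub-add` as the sub-goal this evidence file lands): the crux `VerticalSupportMiddle`
as typed implies that every rational `(p,p)`-class on every smooth projective `(2p+1)`-fold, `p ≥ 1`,
has coniveau `≥ 1` — `verticalSupportMiddle_coniveau_one_of_odd` restated. [folklore] -/
theorem verticalSupportMiddle_imp_coniveau_one_odd : VerticalSupportMiddle → ∀ ⦃p : ℕ⦄ ⦃B : SchemeOver ℂ⦄, 1 ≤ p → IsSmoothProjective (2 * p + 1) B → ∀ c : complexBetti B (2 * p), IsRationalClass c → IsOfHodgeType (2 * p + 1) B (2 * p) p p c → c ∈ supportedClasses B (2 * p) 1 :=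
  fun hMid _ _ hp hB c hc hpp ↦ verticalSupportMiddle_coniveau_one_of_odd hMid hp hB c hc hpp

open Summit.HodgeConjecture.HodgeConjecture.Theses.CurveNetMordellWeil (LefschetzOneOne)

/-! ### The `q = 3` instance: the Hodge conjecture for fourfolds -/

/-- **Descent of supported Hodge classes, degree-aware form** (the tree's
`supportedHodgeClass_mem_algebraicClasses_of_hodgeConjectureFor_lt` with its inductive hypothesis
asked only in the codimensions that occur): on a smooth projective `X` of dimension `n`, a rational
`(p,p)`-class supported in codimension `≥ 1` is algebraic as soon as rational `(d,d)`-classes are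
algebraic on smooth projective `Y` of dimension `m < n` whenever `2d + 2n = 2p + 2m` (i.e. `d < p`).
Proof as printed (Voisin 2025, Cor. 2.12 + Thm. 4.4): `c` dies off a closed `Z = ⋃ⱼ gⱼ(Yⱼ)`
(Hironaka), `c = Σⱼ (gⱼ)_* βⱼ` with `βⱼ` rational Hodge (Deligne `hD` + lift `hV`), the `βⱼ` are
algebraic by hypothesis and Gysin images of algebraic classes are algebraic.
[cite: Voisin2025, Cor. 2.12 (p. 24), Thm. 4.4 and Cor. 4.5 (p. 38)] [cite: DeligneHodgeIII1974, Cor. 8.2.8] -/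
theorem supportedHodgeClass_mem_algebraicClasses_of_codim_lt
    (hD : Deligne1974_ker_restrictCompl_eq_iSup_range_complexGysin)
    (hV : Voisin2025_hodgeClass_lift_complexGysin) {n : ℕ} {X : SchemeOver ℂ}
    (hX : IsSmoothProjective n X) {p : ℕ}
    (ih : ∀ ⦃m d : ℕ⦄ ⦃Y : SchemeOver ℂ⦄, m < n → 2 * d + 2 * n = 2 * p + 2 * m →
      IsSmoothProjective m Y → ∀ β : complexBetti Y (2 * d), IsRationalClass β →
        IsOfHodgeType m Y (2 * d) d d β → β ∈ algebraicClasses Y d)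
    (c : complexBetti X (2 * p)) (hc : IsRationalClass c) (hc' : IsOfHodgeType n X (2 * p) p p c)
    (hsupp : c ∈ supportedClasses X (2 * p) 1) : c ∈ algebraicClasses X p := by
  let μ : OrientationFamily := fun n Y hY ↦ (Motives.ComplexPoints.isOrientableOver ℂ hY).some
  have hμ : μ.HasPoincareDuality := OrientationFamily.hasPoincareDuality μ
  have hS := gysinMap_restrictCompl_eq_zero_of_field.{0, 0} ℂ
  obtain ⟨Z, hZ, hZ1, hcZ⟩ := exists_isClosed_of_mem_supportedClasses hsupp
  obtain ⟨ι, _, m, Y, hY, g, hm, hZeq⟩ := exists_family_iUnion_range_eq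
    Literature.AlgebraicGeometry.Resolution.Hironaka1964_projective_holds hX hZ hZ1
  have h4 := Voisin2025_hodgeClass_lift_complexGysin.mem_iSup_map_of_restrictCompl_eq_zero hD hV
    μ hμ hX hY g hZeq hc hc' hcZ
  refine SetLike.le_def.mp ?_ h4
  refine iSup_le fun j ↦ iSup_le fun d ↦ iSup_le fun hd ↦ ?_
  rw [Submodule.map_le_iff_le_comap, Submodule.span_le]
  rintro β ⟨hβ, hβ'⟩
  rw [SetLike.mem_coe, Submodule.mem_comap]
  exact complexGysin_mem_algebraicClasses hS μ hμ (hY j) hX (g j) (by omega) hd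
    (ih (hm j) hd (hY j) β hβ hβ')

/-- **The crux at `q = 3` implies the Hodge conjecture for `(2,2)`-classes on all smooth projective
FIVEFOLDS**, granted Lefschetz `(1,1)` (the route's own support item `LefschetzOneOne`) and the two
catalogued descent facts (Deligne, Hodge III Cor. 8.2.8; Voisin 2025 Cor. 2.12): a rational
`(2,2)`-class on a fivefold `B` has coniveau `≥ 1` (`verticalSupportMiddle_coniveau_one_of_odd`,
`p = 2`), hence is a sum of Gysin images of rational `(1,1)`-classes on fourfolds (algebraic by
Lefschetz `(1,1)`) and of degree-`0` classes on threefolds (algebraic). [cite: DeligneHodgeIII1974, Cor. 8.2.8]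
[cite: Voisin2025, Cor. 2.12 (p. 24), Thm. 4.4 and Cor. 4.5 (p. 38)] -/
theorem verticalSupportMiddle_hodge_two_two_fivefolds (hMid : VerticalSupportMiddle)
    (hL11 : LefschetzOneOne) (hD : Deligne1974_ker_restrictCompl_eq_iSup_range_complexGysin)
    (hV : Voisin2025_hodgeClass_lift_complexGysin) {B : SchemeOver ℂ}
    (hB : IsSmoothProjective 5 B) (c : complexBetti B (2 * 2)) (hc : IsRationalClass c)
    (hpp : IsOfHodgeType 5 B (2 * 2) 2 2 c) : c ∈ algebraicClasses B 2 := by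
  have hB' : IsSmoothProjective (2 * 2 + 1) B := hB
  have hsupp : c ∈ supportedClasses B (2 * 2) 1 :=
    verticalSupportMiddle_coniveau_one_of_odd hMid (p := 2) (by norm_num) hB' c hc hpp
  refine supportedHodgeClass_mem_algebraicClasses_of_codim_lt hD hV hB (fun m d Y hm hd hY β hβ hβ' ↦ ?_)
    c hc hpp hsupp
  have hd1 : d ≤ 1 := by omega
  interval_cases d
  · rw [algebraicClasses_zero]
    exact Submodule.mem_top
  · exact hL11 hY β hβ hβ'

/-- **The crux at `q = 3` implies the Hodge conjecture for ALL smooth projective complex FOURFOLDS**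
(rational `(2,2)`-classes; degrees `≠ 4` are Lefschetz `(1,1)` and its dual), granted Lefschetz
`(1,1)` and the two catalogued descent facts: by the `ℙ¹`-step of BFNP Lemma 48
(`mem_algebraicClasses_of_projectiveLine_of_preservesHodgeType`, pull-backs only) it suffices to
know the `(2,2)`-classes of the fivefold `B × ℙ¹` algebraic, which is
`verticalSupportMiddle_hodge_two_two_fivefolds`. No curve-net geometry enters: this is what the
`∀ surjective pr` typing of the crux contains at `q = 3`. [cite: BrosnanFangNiePearlstein2009, §6 Lemma 48 (proof)]
[cite: DeligneHodgeIII1974, Cor. 8.2.8] -/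
theorem verticalSupportMiddle_hodge_two_two_fourfolds (hMid : VerticalSupportMiddle)
    (hL11 : LefschetzOneOne) (hD : Deligne1974_ker_restrictCompl_eq_iSup_range_complexGysin)
    (hV : Voisin2025_hodgeClass_lift_complexGysin) {B : SchemeOver ℂ}
    (hB : IsSmoothProjective 4 B) (c : complexBetti B (2 * 2)) (hc : IsRationalClass c)
    (hpp : IsOfHodgeType 4 B (2 * 2) 2 2 c) : c ∈ algebraicClasses B 2 := by
  have hI : hodgePQ_independent_of_hodgeModel := hodgePQ_independent_of_hodgeModel_holds
  have hA : ∀ ⦃n : ℕ⦄ ⦃X : Motives.SchemeOver ℂ⦄, nonempty_hodgeModel n X :=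
    fun _ _ ↦ nonempty_hodgeModel_holds
  have hP : IsSmoothProjective 1 (Motives.projectiveSpace 1 ℂ) :=
    Motives.isSmoothProjective_projectiveSpace_holds ℂ 1
  have hBP : IsSmoothProjective (4 + 1) (B ⊗ Motives.projectiveSpace 1 ℂ) :=
    Motives.IsSmoothProjective.tensor_holds hB hP
  refine mem_algebraicClasses_of_projectiveLine_of_preservesHodgeType hB
    (preservesHodgeType_of_nonempty_hodgeModel hI (hA (X := B ⊗ Motives.projectiveSpace 1 ℂ)) hBP hB
      (fst B (Motives.projectiveSpace 1 ℂ)))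
    (fun κ hκ hκpp ↦ ?_) c hc hpp
  exact verticalSupportMiddle_hodge_two_two_fivefolds hMid hL11 hD hV hBP κ hκ hκpp

/-- **Registered form** (arrow form, one line; registered on item stmt-HodgeConjecture-2782 via
`ledger workitem stub-add`): the crux as typed, with Lefschetz `(1,1)` and the two catalogued descent
facts, implies the Hodge conjecture for `(2,2)`-classes on all smooth projective complex fourfolds —
`verticalSupportMiddle_hodge_two_two_fourfolds` restated. [cite: BrosnanFangNiePearlstein2009, §6 Lemma 48 (proof)] -/
theorem verticalSupportMiddle_imp_hodge_fourfolds : VerticalSupportMiddle → LefschetzOneOne → Deligne1974_ker_restrictCompl_eq_iSup_range_complexGysin → Voisin2025_hodgeClass_lift_complexGysin → ∀ ⦃B : SchemeOver ℂ⦄, IsSmoothProjective 4 B → ∀ c : complexBetti B (2 * 2), IsRationalClass c → IsOfHodgeType 4 B (2 * 2) 2 2 c → c ∈ algebraicClasses B 2 :=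
  fun hMid hL11 hD hV _ hB c hc hpp ↦ verticalSupportMiddle_hodge_two_two_fourfolds hMid hL11 hD hV hB c hc hpp

end Summit.HodgeConjecture.HodgeConjecture.Theorems

end
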